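import Summits.ResolutionOfSingularities.ResolutionOfSingularities.Theorems.UniversalCellsProductDescentPthPowerSliceAlgebra
import Mathlib.RingTheory.LocalRing.ResidueField.Basic
import HarnessLib

/-!
# Cotangent classes ascend along formally smooth local algebras (core of B2′ ⊇, line `pointwise-lexmax-hull`)

Route `ResolutionOfSingularities/WeightedInvariant`, crux `WeightedConstruction`
(stmt-ResolutionOfSingularities-0571), line `pointwise-lexmax-hull`, stub `stub_plexComap` (B2′,
split of `stub_hullUsc`, plan of record CHAIN w43 v0.5), ⊇-half: an admissible chart at `g y₁`
PULLS BACK along a smooth `g` to an admissible chart at `y₁`; the one non-formal ingredient is that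
"part of a regular system of parameters" ascends along the (formally smooth, local) stalk map
`𝒪_{Y, g y₁} → 𝒪_{Y₁, y₁}`. [OURS · L1 W4.3] Local algebra, via Kähler differentials:

* `linearIndependent_one_tmul_map_of_formallySmooth` — for `k → P → S` with `S` formally smooth over
  `P`, the split injection `S ⊗_P Ω_{P/k} → Ω_{S/k}` (`pthPowerSlice_exists_retraction_mapBaseChange`)
  stays injective after any base change `L ⊗_S -`; so `L`-independence of `1 ⊗ ωᵢ` in `L ⊗_P Ω_{P/k}`
  gives `L`-independence of `1 ⊗ dωᵢ` in `L ⊗_S Ω_{S/k}`.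
* `linearIndependent_toCotangent_of_formallySmooth` — `S` local, formally smooth over `P`, `uᵢ ∈ P`
  mapping into `𝔪_S`: if the `1 ⊗ duᵢ ∈ κ(S) ⊗_P Ω_{P/k}` are `κ(S)`-independent then the classes of
  the `uᵢ` in `𝔪_S/𝔪_S²` are `κ(S)`-independent (conormal map `𝔪/𝔪² → κ ⊗_S Ω_{S/k}`, `f̄ ↦ 1 ⊗ df`).

No new mathematics (Matsumura §25–§28 formal smoothness; Stacks 031I); NOT a statement of the
manuscript under review.
-/

noncomputable section

set_option linter.dupNamespace false -- mandated namespace of this single-conjunct summit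

open IsLocalRing TensorProduct KaehlerDifferential

namespace Summit.ResolutionOfSingularities.ResolutionOfSingularities.Theorems

universe u

variable {k P S : Type u} [CommRing k] [CommRing P] [CommRing S] [Algebra k P] [Algebra k S]
  [Algebra P S] [IsScalarTower k P S]

/-- **Split injectivity of `S ⊗_P Ω_{P/k} → Ω_{S/k}` survives base change.** For `k → P → S` with `S`
formally smooth over `P`, an `S`-algebra `L` that is also a compatible `P`-algebra, and `ωᵢ ∈ Ω_{P/k}`
with the `1 ⊗ ωᵢ ∈ L ⊗_P Ω_{P/k}` linearly independent over `L`: the `1 ⊗ dωᵢ ∈ L ⊗_S Ω_{S/k}`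
(images under `Ω_{P/k} → Ω_{S/k}`) are linearly independent over `L`. [folklore] -/
theorem linearIndependent_one_tmul_map_of_formallySmooth [Algebra.FormallySmooth P S] {ι : Type*}
    (ω : ι → Ω[P⁄k]) (L : Type u) [CommRing L] [Algebra S L] [Algebra P L] [IsScalarTower P S L]
    (hω : LinearIndependent L fun i => (1 : L) ⊗ₜ[P] ω i) :
    LinearIndependent L fun i => (1 : L) ⊗ₜ[S] KaehlerDifferential.map k k P S (ω i) := by
  obtain ⟨r, hr⟩ :=
    ProductDescent.Birth.pthPowerSlice_exists_retraction_mapBaseChange (k := k) (P := P) (S := S)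
  have hker : LinearMap.ker ((KaehlerDifferential.mapBaseChange k P S).baseChange L) = ⊥ := by
    refine LinearMap.ker_eq_bot_of_inverse (g := r.baseChange L) ?_
    rw [← LinearMap.baseChange_comp, hr, LinearMap.baseChange_id]
  let e : L ⊗[S] (S ⊗[P] Ω[P⁄k]) ≃ₗ[L] L ⊗[P] Ω[P⁄k] :=
    TensorProduct.AlgebraTensorModule.cancelBaseChange P S L L Ω[P⁄k]
  have h1 : LinearIndependent L (e.symm.toLinearMap ∘ fun i => (1 : L) ⊗ₜ[P] ω i) :=
    hω.map' e.symm.toLinearMap e.symm.ker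
  have h2 := h1.map' _ hker
  have hfun : (fun i => (1 : L) ⊗ₜ[S] KaehlerDifferential.map k k P S (ω i)) =
      ⇑((KaehlerDifferential.mapBaseChange k P S).baseChange L) ∘
        (⇑e.symm.toLinearMap ∘ fun i => (1 : L) ⊗ₜ[P] ω i) := by
    funext i
    simp only [Function.comp_apply, LinearEquiv.coe_coe]
    have he : e.symm ((1 : L) ⊗ₜ[P] ω i) = (1 : L) ⊗ₜ[S] ((1 : S) ⊗ₜ[P] ω i) := by
      rw [LinearEquiv.symm_apply_eq]
      simp [e, TensorProduct.AlgebraTensorModule.cancelBaseChange_tmul]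
    rw [he, LinearMap.baseChange_tmul, KaehlerDifferential.mapBaseChange_tmul, one_smul]
  rw [hfun]
  exact h2

/-- **Cotangent classes ascend along a formally smooth local algebra.** Let `S` be local and formally
smooth over `P` (`k → P → S`), `uᵢ ∈ P` with `uᵢ ↦ fᵢ ∈ 𝔪_S`. If the `1 ⊗ duᵢ ∈ κ(S) ⊗_P Ω_{P/k}` are
linearly independent over the residue field `κ(S)`, then the classes `f̄ᵢ ∈ 𝔪_S/𝔪_S²` are linearly
independent over `κ(S)`: the conormal map `𝔪_S/𝔪_S² → κ(S) ⊗_S Ω_{S/k}`, `f̄ ↦ 1 ⊗ df`, sends `f̄ᵢ`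
to `1 ⊗ duᵢ`, and `linearIndependent_one_tmul_map_of_formallySmooth` applies with `L = κ(S)`.
[folklore] -/
theorem linearIndependent_toCotangent_of_formallySmooth [IsLocalRing S] [Algebra.FormallySmooth P S]
    {ι : Type*} (u : ι → P) (hf : ∀ i, algebraMap P S (u i) ∈ maximalIdeal S)
    (hP : LinearIndependent (ResidueField S) fun i => (1 : ResidueField S) ⊗ₜ[P] D k P (u i)) :
    LinearIndependent (ResidueField S)
      fun i => (maximalIdeal S).toCotangent ⟨algebraMap P S (u i), hf i⟩ := by
  let κ := ResidueField S
  have hsurj : Function.Surjective (algebraMap S κ) := residue_surjective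
  let J : Ideal S := RingHom.ker (algebraMap S κ)
  have hJ : J = maximalIdeal S := by
    change RingHom.ker (algebraMap S κ) = _
    rw [ResidueField.algebraMap_eq, ker_residue]
  have hle : maximalIdeal S ≤ J.comap (AlgHom.id S S) := fun x hx => by
    simpa [hJ] using hx
  let Φ : (maximalIdeal S).Cotangent →ₗ[S] κ ⊗[S] Ω[S⁄k] :=
    kerCotangentToTensor k S κ ∘ₗ Ideal.mapCotangent (maximalIdeal S) J (AlgHom.id S S) hle
  have hΦ : ∀ i, Φ ((maximalIdeal S).toCotangent ⟨algebraMap P S (u i), hf i⟩) =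
      (1 : κ) ⊗ₜ[S] KaehlerDifferential.map k k P S (D k P (u i)) := by
    intro i
    change kerCotangentToTensor k S κ (Ideal.mapCotangent (maximalIdeal S) J (AlgHom.id S S) hle
      ((maximalIdeal S).toCotangent ⟨algebraMap P S (u i), hf i⟩)) = _
    rw [Ideal.mapCotangent_toCotangent, kerCotangentToTensor_toCotangent, KaehlerDifferential.map_D]
    rfl
  let Φκ : (maximalIdeal S).Cotangent →ₗ[κ] κ ⊗[S] Ω[S⁄k] := Φ.extendScalarsOfSurjective hsurj
  refine LinearIndependent.of_comp Φκ ?_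
  have hfun : (Φκ ∘ fun i => (maximalIdeal S).toCotangent ⟨algebraMap P S (u i), hf i⟩) =
      fun i => (1 : κ) ⊗ₜ[S] KaehlerDifferential.map k k P S (D k P (u i)) := by
    funext i
    exact hΦ i
  rw [hfun]
  exact linearIndependent_one_tmul_map_of_formallySmooth (fun i => D k P (u i)) κ hP

/-- **The conormal map of a formally smooth local algebra with formally smooth residue field is
injective on cotangent classes.** For `P` local, formally smooth over `k`, with residue field `κ(P)`
formally smooth over `k` (e.g. a separable extension when `k` is a field): `κ(P)`-independent classes
`ūᵢ ∈ 𝔪_P/𝔪_P²` give `κ(P)`-independent `1 ⊗ duᵢ ∈ κ(P) ⊗_P Ω_{P/k}` — the conormal sequence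
`𝔪/𝔪² → κ ⊗_P Ω_{P/k} → Ω_{κ/k} → 0` is split exact on the left (Stacks 031I,
`Algebra.FormallySmooth.iff_split_injection`). [folklore] -/
theorem linearIndependent_one_tmul_D_of_toCotangent [IsLocalRing P] [Algebra.FormallySmooth k P]
    [Algebra.FormallySmooth k (ResidueField P)] {ι : Type*} (u : ι → P)
    (hu : ∀ i, u i ∈ maximalIdeal P)
    (hli : LinearIndependent (ResidueField P) fun i => (maximalIdeal P).toCotangent ⟨u i, hu i⟩) :
    LinearIndependent (ResidueField P) fun i => (1 : ResidueField P) ⊗ₜ[P] D k P (u i) := by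
  let κ := ResidueField P
  have hsurj : Function.Surjective (algebraMap P κ) := residue_surjective
  obtain ⟨l, hl⟩ :=
    (Algebra.FormallySmooth.iff_split_injection (R := k) (P := P) (A := κ) hsurj).mp inferInstance
  let J : Ideal P := RingHom.ker (algebraMap P κ)
  have hJ : J = maximalIdeal P := by
    change RingHom.ker (algebraMap P κ) = _
    rw [ResidueField.algebraMap_eq, ker_residue]
  have hle : maximalIdeal P ≤ J.comap (AlgHom.id P P) := fun x hx => by
    simpa [hJ] using hx
  let ψ : (maximalIdeal P).Cotangent →ₗ[P] J.Cotangent :=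
    Ideal.mapCotangent (maximalIdeal P) J (AlgHom.id P P) hle
  have hψ : ∀ x, ψ x = 0 → x = 0 := by
    intro x hx
    obtain ⟨y, rfl⟩ := (maximalIdeal P).toCotangent_surjective x
    change Ideal.mapCotangent (maximalIdeal P) J (AlgHom.id P P) hle
      ((maximalIdeal P).toCotangent y) = 0 at hx
    rw [Ideal.mapCotangent_toCotangent, Ideal.toCotangent_eq_zero] at hx
    rw [Ideal.toCotangent_eq_zero]
    have hy : (y : P) ∈ J ^ 2 := hx
    rw [hJ] at hy
    exact hy
  let Φ : (maximalIdeal P).Cotangent →ₗ[P] κ ⊗[P] Ω[P⁄k] := kerCotangentToTensor k P κ ∘ₗ ψ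
  have hΦ : ∀ x, Φ x = 0 → x = 0 := by
    intro x hx
    apply hψ
    have h1 : l (kerCotangentToTensor k P κ (ψ x)) = ψ x := LinearMap.congr_fun hl (ψ x)
    rw [← h1]
    change l (Φ x) = 0
    rw [hx, map_zero]
  let Φκ : (maximalIdeal P).Cotangent →ₗ[κ] κ ⊗[P] Ω[P⁄k] := Φ.extendScalarsOfSurjective hsurj
  have hΦκ : LinearMap.ker Φκ = ⊥ := LinearMap.ker_eq_bot'.mpr fun x hx => hΦ x hx
  have hfun : (fun i => (1 : κ) ⊗ₜ[P] D k P (u i)) =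
      Φκ ∘ fun i => (maximalIdeal P).toCotangent ⟨u i, hu i⟩ := by
    funext i
    change _ = kerCotangentToTensor k P κ (ψ ((maximalIdeal P).toCotangent ⟨u i, hu i⟩))
    rw [Ideal.mapCotangent_toCotangent, kerCotangentToTensor_toCotangent]
    rfl
  rw [hfun]
  exact hli.map' Φκ hΦκ

/-- **Base change of `1 ⊗ vᵢ` along the residue field extension of a local homomorphism.** For a local
homomorphism `P → S` of local rings and a `P`-module `V`: if the `1 ⊗ vᵢ ∈ κ(P) ⊗_P V` are
`κ(P)`-independent, the `1 ⊗ vᵢ ∈ κ(S) ⊗_P V` are `κ(S)`-independent (field extensions are flat;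
`κ(S) ⊗_{κ(P)} (κ(P) ⊗_P V) ≅ κ(S) ⊗_P V`). [folklore] -/
theorem linearIndependent_one_tmul_residueField_of_isLocalHom [IsLocalRing P] [IsLocalRing S]
    [IsLocalHom (algebraMap P S)] {ι : Type*} {V : Type u} [AddCommGroup V] [Module P V]
    (v : ι → V)
    (h : LinearIndependent (ResidueField P) fun i => (1 : ResidueField P) ⊗ₜ[P] v i) :
    LinearIndependent (ResidueField S) fun i => (1 : ResidueField S) ⊗ₜ[P] v i := by
  let κP := ResidueField P
  let κS := ResidueField S
  have h1 : LinearIndependent κS fun i => (1 : κS) ⊗ₜ[κP] ((1 : κP) ⊗ₜ[P] v i) :=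
    Module.Flat.linearIndependent_one_tmul h
  let e : κS ⊗[κP] (κP ⊗[P] V) ≃ₗ[κS] κS ⊗[P] V :=
    TensorProduct.AlgebraTensorModule.cancelBaseChange P κP κS κS V
  have h2 := h1.map' e.toLinearMap e.ker
  have hfun : (fun i => (1 : κS) ⊗ₜ[P] v i) =
      ⇑e.toLinearMap ∘ fun i => (1 : κS) ⊗ₜ[κP] ((1 : κP) ⊗ₜ[P] v i) := by
    funext i
    simp only [Function.comp_apply, LinearEquiv.coe_coe, e,
      TensorProduct.AlgebraTensorModule.cancelBaseChange_tmul, one_smul]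
  rw [hfun]
  exact h2

/-- **"Part of a regular system of parameters" ascends along smooth local maps (core of B2′ ⊇).**
Let `P → S` be a LOCAL homomorphism of local rings over `k` with `S` formally smooth over `P`, `P`
formally smooth over `k` and `κ(P)` formally smooth over `k` (for the line: stalks of smooth
`k`-schemes at closed points over a perfect field, and the stalk map of a smooth morphism). If
`u₁,…,u_m ∈ 𝔪_P` have `κ(P)`-linearly independent classes in `𝔪_P/𝔪_P²`, then their images in `𝔪_S`
have `κ(S)`-linearly independent classes in `𝔪_S/𝔪_S²`. [folklore] -/
theorem linearIndependent_toCotangent_map_of_formallySmooth [IsLocalRing P] [IsLocalRing S]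
    [IsLocalHom (algebraMap P S)] [Algebra.FormallySmooth k P]
    [Algebra.FormallySmooth k (ResidueField P)] [Algebra.FormallySmooth P S] {ι : Type*} (u : ι → P)
    (hu : ∀ i, u i ∈ maximalIdeal P)
    (hli : LinearIndependent (ResidueField P) fun i => (maximalIdeal P).toCotangent ⟨u i, hu i⟩) :
    LinearIndependent (ResidueField S) fun i =>
      (maximalIdeal S).toCotangent ⟨algebraMap P S (u i), map_nonunit (algebraMap P S) (u i) (hu i)⟩ :=
  linearIndependent_toCotangent_of_formallySmooth (k := k) u _
    (linearIndependent_one_tmul_residueField_of_isLocalHom _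
      (linearIndependent_one_tmul_D_of_toCotangent (k := k) u hu hli))

end Summit.ResolutionOfSingularities.ResolutionOfSingularities.Theorems

end
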